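import Summits.CriticalPhenomena.Ising3DConformalLimit.Theses.PlantedPinning
import Summits.CriticalPhenomena.Ising3DConformalLimit.Theses.CurrentConnectionInvariance

/-!
# Strategy-census sketch (cstrat seat s7) for crux `PlantedPinning.PinningEfficiencyDeficit`
(item stmt-CriticalPhenomena-8451).

Typed signatures quoted in `STRATEGY-CENSUS-s7.md`.  Sorry-free; nothing here is a registered line.

* `NonSaturation` — the weakest summit-side replacement of the crux found (liminf form of e* < 1):
  `closes_of_nonSaturation` re-proves the route's deciding theorem from it, and
  `nonSaturation_of_deficit` shows it is implied by the crux.  (Census §1: logically weaker, same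
  infrared content.)
* `ValueSlack` — the strengthening S⁺ of the registered stub S1 (`stub_csSlackWindow`) isolating the
  value-sensitivity of the local conditional susceptibility χ_z (census `## Strengthen`).
* `NonGaussianForcesValueSlack` — the bridge piece of the best typed split (census `## Decomposition`),
  stated over the existing lattice crux `CurrentConnectionInvariance.NormalisedU4Nonvanishing`.
-/

namespace Summit.CriticalPhenomena.Ising3DConformalLimit.Cruxes.PinningEfficiencyDeficit.CensusS7

open Summit.CriticalPhenomena.Ising3DConformalLimit.Theses.PlantedPinning
open scoped BigOperators

/-- NON-SATURATION (liminf form): some ε > 0 such that for arbitrarily small densities p the planted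
pinning efficiency e_L(⌈p·n⌉) drops below 1 − ε along a sequence of volumes.  Same `let`-chain as the
route items, so `eff` is literally the route's efficiency. -/
def NonSaturation : Prop :=
  let βc : ℝ := Literature.Probability.LatticeModels.criticalBeta 3; let M : ℕ → Literature.Probability.LatticeModels.SpinConfig (Literature.Probability.LatticeModels.Site 3) → ℝ := fun L σ => ∑ x ∈ Literature.Probability.LatticeModels.box 3 L, Literature.Probability.LatticeModels.spinAt x σ; let cvar : ℕ → Finset (Literature.Probability.LatticeModels.Site 3) → Literature.Probability.LatticeModels.SpinConfig (Literature.Probability.LatticeModels.Site 3) → ℝ := fun L P η => Literature.Probability.LatticeModels.isingExpect (Literature.Probability.LatticeModels.zdGraph 3) (Literature.Probability.LatticeModels.box 3 L \ P) βc 0 (.fixed η) (fun σ => M L σ ^ 2) - Literature.Probability.LatticeModels.isingExpect (Literature.Probability.LatticeModels.zdGraph 3) (Literature.Probability.LatticeModels.box 3 L \ P) βc 0 (.fixed η) (M L) ^ 2; let pvar : ℕ → ℕ → ℝ := fun L k => (∑ P ∈ (Literature.Probability.LatticeModels.box 3 L).powersetCard k, ∑ τ : ↥(Literature.Probability.LatticeModels.box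 3 L) → ℤˣ, Literature.Probability.LatticeModels.isingWeight (Literature.Probability.LatticeModels.zdGraph 3) (Literature.Probability.LatticeModels.box 3 L) βc 0 .plus τ / Literature.Probability.LatticeModels.isingPartitionFunction (Literature.Probability.LatticeModels.zdGraph 3) (Literature.Probability.LatticeModels.box 3 L) βc 0 .plus * cvar L P (Literature.Probability.LatticeModels.glue (Literature.Probability.LatticeModels.box 3 L) τ .plus)) / ((Literature.Probability.LatticeModels.box 3 L).card.choose k : ℝ); let eff : ℕ → ℕ → ℝ := fun L k => (k : ℝ) * pvar L k / ((((Literature.Probability.LatticeModels.box 3 L).card : ℝ) + 1) * (((Literature.Probability.LatticeModels.box 3 L).card : ℝ) - k + 1)); ∃ ε : ℝ, 0 < ε ∧ ∀ p₀ : ℝ, 0 < p₀ → ∃ p : ℝ, 0 < p ∧ p < p₀ ∧ ∀ L₀ : ℕ, ∃ L ≥ L₀, eff L ⌈p * ((Literature.Probability.LatticeModels.box 3 L).card : ℝ)⌉₊ ≤ 1 - ε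

/-- The crux implies the liminf form (pure logic). -/
theorem nonSaturation_of_deficit : PinningEfficiencyDeficit → NonSaturation := by
  intro h
  obtain ⟨ε, hε, p₀, hp₀, hdef⟩ := h
  refine ⟨ε, hε, ?_⟩
  intro p₁ hp₁
  have hmin : 0 < min p₀ p₁ := lt_min hp₀ hp₁
  have hle₀ : min p₀ p₁ ≤ p₀ := min_le_left p₀ p₁
  have hle₁ : min p₀ p₁ ≤ p₁ := min_le_right p₀ p₁
  obtain ⟨L₀, hL₀⟩ := hdef (min p₀ p₁ / 2) (by linarith) (by linarith)
  refine ⟨min p₀ p₁ / 2, by linarith, by linarith, ?_⟩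
  intro L₁
  exact ⟨max L₀ L₁, le_max_right L₀ L₁, hL₀ (max L₀ L₁) (le_max_left L₀ L₁)⟩

/-- The route's deciding theorem survives the weakening: NonSaturation + GaussianPinningSaturation +
MoebiusLimitExists ⊢ Ising3DConformalLimit (same contradiction, one volume instead of all). -/
theorem closes_of_nonSaturation :
    NonSaturation → GaussianPinningSaturation → MoebiusLimitExists → _root_.Ising3DConformalLimit := by
  intro hNS hSat hMoeb
  obtain ⟨ρ, Δ, S, hρ, hΔ, hlim, hnd, hmob⟩ := hMoeb
  refine ⟨ρ, Δ, S, hρ, hΔ, hlim, hnd, hmob, ?_⟩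
  by_contra hU4
  obtain ⟨ε, hε, hns⟩ := hNS
  obtain ⟨p₁, hp₁, hsat⟩ := hSat ρ Δ S hρ hΔ hlim hnd hmob hU4 (ε / 2) (by linarith)
  obtain ⟨p, hp, hpp₁, hL⟩ := hns p₁ hp₁
  obtain ⟨L₁, hL₁⟩ := hsat p hp hpp₁
  obtain ⟨L, hLL₁, hle⟩ := hL L₁
  have h₁ := hL₁ L hLL₁
  linarith

/-! ## Strengthen: the value-slack S⁺ behind stub S1

Notation (3D, β = β_c(3), h = 0, plus boundary condition on Λ = box 3 L, pins P ⊆ Λ with planted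
pattern τ): `condE L P τ f` = conditional expectation given σ_P = τ_P; `chi L P τ z` = Cov(M_Λ, σ_z | pins)
(local conditional susceptibility); `wτ` = planted weight of τ. -/

noncomputable section

open Literature.Probability.LatticeModels in
/-- planted weight of the pattern τ under μ⁺_{Λ_L; β_c, 0}. -/
def wτ (L : ℕ) (τ : ↥(box 3 L) → ℤˣ) : ℝ :=
  isingWeight (zdGraph 3) (box 3 L) (criticalBeta 3) 0 .plus τ /
    isingPartitionFunction (zdGraph 3) (box 3 L) (criticalBeta 3) 0 .plus

open Literature.Probability.LatticeModels in
/-- total magnetisation of the box. -/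
def Mbox (L : ℕ) (σ : SpinConfig (Site 3)) : ℝ := ∑ x ∈ box 3 L, spinAt x σ

open Literature.Probability.LatticeModels in
/-- conditional expectation given the pins (Ising measure on Λ ∖ P with boundary condition glue τ +). -/
def condE (L : ℕ) (P : Finset (Site 3)) (τ : ↥(box 3 L) → ℤˣ) (f : SpinConfig (Site 3) → ℝ) : ℝ :=
  isingExpect (zdGraph 3) (box 3 L \ P) (criticalBeta 3) 0 (.fixed (glue (box 3 L) τ .plus)) f

open Literature.Probability.LatticeModels in
/-- χ_z = Cov(M, σ_z | pins), the local conditional susceptibility. -/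
def chi (L : ℕ) (P : Finset (Site 3)) (τ : ↥(box 3 L) → ℤˣ) (z : Site 3) : ℝ :=
  condE L P τ (fun σ => Mbox L σ * spinAt z σ) - condE L P τ (Mbox L) * condE L P τ (fun σ => spinAt z σ)

open Literature.Probability.LatticeModels in
/-- planted conditional variance v_{L,j} (the route's `pvar`). -/
def pvar (L j : ℕ) : ℝ :=
  (∑ P ∈ (box 3 L).powersetCard j, ∑ τ : ↥(box 3 L) → ℤˣ,
      wτ L τ * (condE L P τ (fun σ => Mbox L σ ^ 2) - condE L P τ (Mbox L) ^ 2)) / ((box 3 L).card.choose j : ℝ)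

open Literature.Probability.LatticeModels in
/-- value-averaged local susceptibility χ̄_z(P) = E_τ χ_z. -/
def chibar (L : ℕ) (P : Finset (Site 3)) (z : Site 3) : ℝ := ∑ τ : ↥(box 3 L) → ℤˣ, wτ L τ * chi L P τ z

open Literature.Probability.LatticeModels in
/-- VALUE VARIANCE of χ_z: E_P (n − j) Σ_{z ∉ P} Var_τ(χ_z) (only the planted VALUES vary). -/
def valueVar (L j : ℕ) : ℝ :=
  (∑ P ∈ (box 3 L).powersetCard j, (((box 3 L).card : ℝ) - j) *
      ∑ z ∈ box 3 L \ P, ∑ τ : ↥(box 3 L) → ℤˣ, wτ L τ * (chi L P τ z - chibar L P z) ^ 2) /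
    ((box 3 L).card.choose j : ℝ)

open Literature.Probability.LatticeModels in
/-- S⁺ (Strengthen): a uniform VALUE-slack floor in the crossover window — the value-sensitivity of the
conditional covariance (amplitude A_val of the lead's numerics) stays ≥ s as p → 0.  By the law of total
variance csq − pvar² = (n−j)²·Var_{P,τ,z}(χ) ≥ valueVar, so ValueSlack ⟹ stub_csSlackWindow (S1) with
the same s; it is the physics of S1 isolated, not an easier statement (census `## Strengthen`). -/
def ValueSlack : Prop :=
  ∃ s : ℝ, 0 < s ∧ ∃ p₀ : ℝ, 0 < p₀ ∧ ∀ p : ℝ, 0 < p → p < p₀ → ∃ L₀ : ℕ, ∀ L ≥ L₀, ∀ j : ℕ,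
    ⌈p * ((box 3 L).card : ℝ)⌉₊ ≤ 2 * j → j < ⌈p * ((box 3 L).card : ℝ)⌉₊ → s * pvar L j ^ 2 ≤ valueVar L j

/-- Decomposition, bridge piece (NO PLAN — recorded, not filed): lattice non-Gaussianity at macroscopic
separation (the shared crux `NormalisedU4Nonvanishing`, which already implies item 0636 and hence clause
(iii)) would have to FORCE value-sensitivity of planted pinning.  This is the converse direction of r3
(GaussianPinningSaturation) and needs the same non-existent conditional limit theory at scale L*(p). -/
def NonGaussianForcesValueSlack : Prop :=
  Summit.CriticalPhenomena.Ising3DConformalLimit.Theses.CurrentConnectionInvariance.NormalisedU4Nonvanishing →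
    ValueSlack

end

end Summit.CriticalPhenomena.Ising3DConformalLimit.Cruxes.PinningEfficiencyDeficit.CensusS7
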